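import Summits.AtomisticToContinuum.FouriersLaw.Theorems.BondHeatUncertaintyExtensiveSnapshotIrreversibilityEnergyWindowCostateComponents
import HarnessLib

/-!
# Bond heat uncertainty — energy window: the site-transfer steps of a path costate
  (rung (C2h) beneath the open leaf (COF): the interpolation moves (C2a)/(C2b) INSTANTIATED on the
  costate coordinates, the pointwise sub-diagonal solve, and the absorption lemma of the induction)

Cell `decomp-a2c`, lens-1 «grading / quantitative ladder», generation 84, crux
`stmt-AtomisticToContinuum-9121` (`ExtensiveSnapshotIrreversibility`, K_fix half, leaf S3), part S
(imports part R `…EnergyWindowCostateComponents` + HarnessLib).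
Write a path costate as `c(r) = (α(r), β(r))` (`α = c.1`, `β = c.2`), `S` an a-priori bound of
`‖c‖` on `[0,s]` (part M), `Λ` a sup bound of the Hessian along the path on `[0,s]` (part Q),
`Θ_θ` the energy budget.  The site transfer that proves (COF) (memo NODE-g84 §5) is the chain
`∫β_0² small ⟹ β_0 small ⟹ β̇_0, α_0 small ⟹ α̇_0 small ⟹ β_1 small ⟹ …` (all "small" in sup
norm on `[0,s]`, `s ∈ [1/2, 1]`).  This file proves EACH LINK as a standalone inequality:

* (T0) `IsPathCostate.abs_snd_pow_three_le_of_integral_sq` — observation to sup: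
  `|β_i(t)|³ ≤ 8(1+2γ)S ∫₀ˢβ_i² ∨ |β_i(t)|² s ≤ 8 ∫₀ˢβ_i²` (part N (C2a), `β_i` Lipschitz by R);
* (TA) `IsPathCostate.abs_betaDot_pow_three_le` — `sup|β_i| ≤ ε ⟹
  |β̇_i(t)|³ ≤ 16 ε ((NΛ + 2γ(1+2γ))S)² ∨ |β̇_i(t)| s ≤ 8ε` (part N (C2b), `β̇_i` Lipschitz by R,
  Lipschitz ⟹ Hölder-½ on an interval of length `≤ 1`);
* (TD) `abs_fst_apply_le_abs_coDrift_snd_add` — `|α_i| ≤ |β̇_i| + 2γ|β_i|` pointwise;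
* (TB) `IsPathCostate.abs_alphaDot_pow_three_le` — `sup|α_j| ≤ ε ⟹
  |α̇_j(t)|³ ≤ 16 ε · 2N²((1+2γ)²Λ² + C_D²(2/θ²)Θ_θ) S² ∨ |α̇_j(t)| s ≤ 8ε`
  (part N (C2b) with the Hölder-½ modulus of `α̇_j` from R's `L²` bound of `α̈_j`);
* (TC) `abs_snd_succ_le` — the POINTWISE SUB-DIAGONAL SOLVE: for `j' = j+1`,
  `|β_{j'}| ≤ |Σ_i β_i ∂²Φ_{ij}(q)| + N Λ max_{i ≤ j}|β_i|`, because the Hessian is tridiagonal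
  (tree `hessPotential_eq_zero_of_le`) and its sub-diagonal entry is `-V''(q_{j'} - q_j)` with
  `V'' = 1 + 3βr² ≥ 1` (tree `hessPotential_succ`, `pinnedChain_deriv_deriv_V`);
* (G) `le_of_pow_three_le_or` — the absorption step `x³ ≤ A ∨ x ≤ B`, `A ≤ δ³`, `B ≤ δ ⟹ x ≤ δ`
  used at every link of the induction (all exponents stay natural numbers, memo §5).

What remains for (COF) after this file is bookkeeping only: the induction over sites with the
links above and the closure by 2-homogeneity (memo NODE-g84 §5, generation 85).

References: parts M, N, Q, R; tree `LangevinChainHormander` (`hessPotential_succ`,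
`hessPotential_eq_zero_of_le`, `pinnedChain_deriv_deriv_V`).
-/

namespace Summit.AtomisticToContinuum.FouriersLaw.Theorems.ExtensiveSnapshotIrreversibility.EnergyWindow

open MeasureTheory Filter Topology Set Finset
open scoped Nat
open Literature.MathematicalPhysics.KineticTheory.HeatConduction Literature.Probability.Process

/-! ## 1. Two elementary real lemmas -/

/-- On `[0, 1]`: `a ≤ √a` (Lipschitz ⟹ Hölder-½ on intervals of length `≤ 1`). [folklore] -/
theorem le_sqrt_self_of_le_one {a : ℝ} (h0 : 0 ≤ a) (h1 : a ≤ 1) : a ≤ √a := by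
  calc a = √(a ^ 2) := (Real.sqrt_sq h0).symm
    _ ≤ √a := Real.sqrt_le_sqrt (by nlinarith)

/-- **Absorption step of the site-transfer induction**: from the disjunction produced by the
interpolation moves (C2a)/(C2b), `x³ ≤ A ∨ x ≤ B`, and a designated next bound `δ ≥ 0` with
`A ≤ δ³`, `B ≤ δ`, conclude `x ≤ δ`. [folklore] -/
theorem le_of_pow_three_le_or {x A B δ : ℝ} (hδ : 0 ≤ δ) (h : x ^ 3 ≤ A ∨ x ≤ B)
    (hA : A ≤ δ ^ 3) (hB : B ≤ δ) : x ≤ δ := by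
  rcases h with h | h
  · exact le_of_pow_le_pow_left₀ (by norm_num) hδ (h.trans hA)
  · exact h.trans hB

/-- (TD) **`α_i` from `β̇_i` and `β_i`**: `|x.1 i| ≤ |-x.1 i + γ w_i x.2 i| + 2γ |x.2 i|`
(`w_i ∈ [0, 2]`). [folklore] -/
theorem abs_fst_apply_le_abs_coDrift_snd_add {γ : ℝ} (hγ : 0 ≤ γ) {N : ℕ} (x : PhaseSpace N)
    (i : Fin N) :
    |x.1 i| ≤ |-x.1 i + γ * OscillatorChain.bathWeight N i * x.2 i| + 2 * γ * |x.2 i| := by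
  have hw0 := bathWeight_nonneg N i
  have hw2 := bathWeight_le_two N i
  have h1 : x.1 i = -(-x.1 i + γ * OscillatorChain.bathWeight N i * x.2 i) +
      γ * OscillatorChain.bathWeight N i * x.2 i := by ring
  calc |x.1 i| = |-(-x.1 i + γ * OscillatorChain.bathWeight N i * x.2 i) +
        γ * OscillatorChain.bathWeight N i * x.2 i| := by rw [← h1]
    _ ≤ |-(-x.1 i + γ * OscillatorChain.bathWeight N i * x.2 i)| +
        |γ * OscillatorChain.bathWeight N i * x.2 i| := abs_add_le _ _
    _ = |-x.1 i + γ * OscillatorChain.bathWeight N i * x.2 i| +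
        γ * OscillatorChain.bathWeight N i * |x.2 i| := by
          rw [abs_neg, abs_mul, abs_of_nonneg (mul_nonneg hγ hw0)]
    _ ≤ |-x.1 i + γ * OscillatorChain.bathWeight N i * x.2 i| + 2 * γ * |x.2 i| := by
          gcongr _ + ?_
          calc γ * OscillatorChain.bathWeight N i * |x.2 i| ≤ γ * 2 * |x.2 i| := by gcongr
            _ = 2 * γ * |x.2 i| := by ring

section Costate

variable {ω₂ lam β γ : ℝ} {N : ℕ} {T_L T_R : ℝ}

/-! ## 2. (TC) The pointwise sub-diagonal solve -/

/-- (TC) **Pointwise sub-diagonal solve.**  If `|∂²Φ_{ij}(q)| ≤ Λ` for all `i, j`, `j' = j + 1`,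
and `|x.2 i| ≤ m` for every site `i ≤ j`, then
`|x.2 j'| ≤ |Σ_i x.2 i ∂²Φ_{ij}(q)| + N Λ m`:
the Hessian is tridiagonal, so `Σ_i x.2 i ∂²Φ_{ij} = x.2 j' ∂²Φ_{j'j} + Σ_{i ≤ j} x.2 i ∂²Φ_{ij}`,
and `|∂²Φ_{j'j}(q)| = V''(q_{j'} - q_j) = 1 + 3β(q_{j'} - q_j)² ≥ 1`.  This is the move that
transfers sup-smallness from `α̇_j` (and the sites `≤ j`) to the NEXT site `j + 1`, with no loss
of derivatives. [NEW · rung (C2h) beneath (COF)] -/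
theorem abs_snd_succ_le (hβ : 0 ≤ β) {q : Fin N → ℝ} {Λ m : ℝ}
    (hΛ : ∀ i j, |(pinnedChain ω₂ lam β γ).hessPotential N i j q| ≤ Λ) (x : PhaseSpace N)
    {j j' : Fin N} (hj : j'.val = j.val + 1) (hm : ∀ i : Fin N, i.val ≤ j.val → |x.2 i| ≤ m) :
    |x.2 j'| ≤ |∑ i, x.2 i * (pinnedChain ω₂ lam β γ).hessPotential N i j q| +
      (N : ℝ) * (Λ * m) := by
  have hm0 : 0 ≤ m := (abs_nonneg _).trans (hm j le_rfl)
  -- the sub-diagonal entry has modulus ≥ 1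
  have hsub : 1 ≤ |(pinnedChain ω₂ lam β γ).hessPotential N j' j q| := by
    rw [(pinnedChain ω₂ lam β γ).hessPotential_succ N hj q, pinnedChain_deriv_deriv_V, abs_neg,
      abs_of_nonneg (by positivity)]
    nlinarith [sq_nonneg (q j' - q j)]
  -- every other term is `≤ Λ m` in modulus (and vanishes for `i ≥ j + 2`)
  have hterm : ∀ i ∈ univ.erase j',
      |x.2 i * (pinnedChain ω₂ lam β γ).hessPotential N i j q| ≤ Λ * m := by
    intro i hi
    have hij' : i ≠ j' := (Finset.mem_erase.1 hi).1
    by_cases hle : i.val ≤ j.val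
    · rw [abs_mul]
      calc |x.2 i| * |(pinnedChain ω₂ lam β γ).hessPotential N i j q| ≤ m * Λ :=
            mul_le_mul (hm i hle) (hΛ i j) (abs_nonneg _) hm0
        _ = Λ * m := mul_comm _ _
    · have h2 : j.val + 2 ≤ i.val := by
        have : i.val ≠ j'.val := fun e => hij' (Fin.ext e)
        omega
      rw [(pinnedChain ω₂ lam β γ).hessPotential_eq_zero_of_le N h2 q, mul_zero, abs_zero]
      exact mul_nonneg ((abs_nonneg _).trans (hΛ j j)) hm0
  have hsplit : x.2 j' * (pinnedChain ω₂ lam β γ).hessPotential N j' j q =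
      ∑ i, x.2 i * (pinnedChain ω₂ lam β γ).hessPotential N i j q -
        ∑ i ∈ univ.erase j', x.2 i * (pinnedChain ω₂ lam β γ).hessPotential N i j q := by
    rw [← Finset.add_sum_erase univ
      (fun i => x.2 i * (pinnedChain ω₂ lam β γ).hessPotential N i j q) (mem_univ j')]
    ring
  have herase : |∑ i ∈ univ.erase j', x.2 i * (pinnedChain ω₂ lam β γ).hessPotential N i j q| ≤
      (N : ℝ) * (Λ * m) := by
    calc |∑ i ∈ univ.erase j', x.2 i * (pinnedChain ω₂ lam β γ).hessPotential N i j q|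
        ≤ ∑ i ∈ univ.erase j', |x.2 i * (pinnedChain ω₂ lam β γ).hessPotential N i j q| :=
          abs_sum_le_sum_abs _ _
      _ ≤ ∑ i ∈ univ.erase j', Λ * m := Finset.sum_le_sum hterm
      _ = ((univ.erase j').card : ℝ) * (Λ * m) := by rw [sum_const, nsmul_eq_mul]
      _ ≤ (N : ℝ) * (Λ * m) := by
          have hc : ((univ.erase j').card : ℝ) ≤ N := by
            exact_mod_cast (Finset.card_erase_le).trans (by simp)
          exact mul_le_mul_of_nonneg_right hc (mul_nonneg ((abs_nonneg _).trans (hΛ j j)) hm0)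
  calc |x.2 j'| ≤ |x.2 j'| * |(pinnedChain ω₂ lam β γ).hessPotential N j' j q| :=
        le_mul_of_one_le_right (abs_nonneg _) hsub
    _ = |∑ i, x.2 i * (pinnedChain ω₂ lam β γ).hessPotential N i j q -
          ∑ i ∈ univ.erase j', x.2 i * (pinnedChain ω₂ lam β γ).hessPotential N i j q| := by
        rw [← abs_mul, hsplit]
    _ ≤ |∑ i, x.2 i * (pinnedChain ω₂ lam β γ).hessPotential N i j q| +
          |∑ i ∈ univ.erase j', x.2 i * (pinnedChain ω₂ lam β γ).hessPotential N i j q| :=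
        abs_sub _ _
    _ ≤ |∑ i, x.2 i * (pinnedChain ω₂ lam β γ).hessPotential N i j q| + (N : ℝ) * (Λ * m) := by
        gcongr

/-! ## 3. (T0), (TA), (TB): the interpolation moves on the costate coordinates -/

/-- (T0) **Observation to sup** (part N (C2a) on `β_i`, Lipschitz constant `(1+2γ)S` from part R):
for `t ∈ [0, s]`, `|β_i(t)|³ ≤ 8(1+2γ)S ∫₀ˢ β_i² ∨ |β_i(t)|² s ≤ 8 ∫₀ˢ β_i²`.
[NEW · rung (C2h) beneath (COF)] -/
theorem IsPathCostate.abs_snd_pow_three_le_of_integral_sq (hγ : 0 ≤ γ) {s : ℝ} (hs : 0 < s)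
    {z : PhaseSpace N} {wp : WienerPair} {c : ℝ → PhaseSpace N}
    (hc : IsPathCostate ω₂ lam β γ N T_L T_R s z wp c) {S : ℝ} (hS0 : 0 ≤ S)
    (hS : ∀ t ∈ Icc 0 s, ‖c t‖ ≤ S) (i : Fin N) {t : ℝ} (ht : t ∈ Icc 0 s) :
    |(c t).2 i| ^ 3 ≤ 8 * ((1 + 2 * γ) * S) * ∫ u in (0 : ℝ)..s, ((c u).2 i) ^ 2 ∨
      |(c t).2 i| ^ 2 * s ≤ 8 * ∫ u in (0 : ℝ)..s, ((c u).2 i) ^ 2 := by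
  have hcont : ContinuousOn (fun t => (c t).2 i) (Icc 0 s) :=
    ((continuous_apply i).comp continuous_snd).comp_continuousOn hc.1
  have h := abs_pow_three_le_of_lipschitz_of_integral_sq (f := fun t => (c t).2 i) hs hcont
    (by positivity : 0 ≤ (1 + 2 * γ) * S) (fun t ht u hu => hc.abs_snd_sub_le hγ hS i ht hu) ht
  rw [sub_zero] at h
  exact h

/-- (TA) **`sup |β_i| ≤ ε ⟹ β̇_i` is cube-small** (part N (C2b) with `f = β_i`, `g = β̇_i =
-α_i + γ w_i β_i`, Hölder-½ constant `(NΛ + 2γ(1+2γ))S` from the Lipschitz bound of part R on an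
interval of length `s ≤ 1`): for `t ∈ [0, s]`,
`|β̇_i(t)|³ ≤ 16 ε ((NΛ + 2γ(1+2γ))S)² ∨ |β̇_i(t)| s ≤ 8 ε`. [NEW · rung (C2h) beneath (COF)] -/
theorem IsPathCostate.abs_betaDot_pow_three_le (hγ : 0 ≤ γ) {s : ℝ} (hs0 : 0 < s) (hs1 : s ≤ 1)
    {z : PhaseSpace N} {wp : WienerPair} {c : ℝ → PhaseSpace N}
    (hc : IsPathCostate ω₂ lam β γ N T_L T_R s z wp c) {S Λ ε : ℝ} (hS0 : 0 ≤ S)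
    (hS : ∀ t ∈ Icc 0 s, ‖c t‖ ≤ S) (hΛ0 : 0 ≤ Λ)
    (hΛ : ∀ t ∈ Icc 0 s, ∀ i j, |(pinnedChain ω₂ lam β γ).hessPotential N i j
      ((pinnedChain ω₂ lam β γ).solMap N T_L T_R t z (pairPath wp)).1| ≤ Λ)
    (i : Fin N) (hε : ∀ t ∈ Icc 0 s, |(c t).2 i| ≤ ε) {t : ℝ} (ht : t ∈ Icc 0 s) :
    |-(c t).1 i + γ * OscillatorChain.bathWeight N i * (c t).2 i| ^ 3 ≤
        16 * ε * (((N : ℝ) * Λ + 2 * γ * (1 + 2 * γ)) * S) ^ 2 ∨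
      |-(c t).1 i + γ * OscillatorChain.bathWeight N i * (c t).2 i| * s ≤ 8 * ε := by
  have hcont : ContinuousOn (fun t => (c t).2 i) (Icc 0 s) :=
    ((continuous_apply i).comp continuous_snd).comp_continuousOn hc.1
  have hM : 0 ≤ ((N : ℝ) * Λ + 2 * γ * (1 + 2 * γ)) * S := by positivity
  have hmod : ∀ x ∈ Icc 0 s, ∀ y ∈ Icc 0 s,
      |(-(c x).1 i + γ * OscillatorChain.bathWeight N i * (c x).2 i) -
          (-(c y).1 i + γ * OscillatorChain.bathWeight N i * (c y).2 i)| ≤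
        ((N : ℝ) * Λ + 2 * γ * (1 + 2 * γ)) * S * √|x - y| := by
    intro x hx y hy
    refine (hc.abs_betaDot_sub_le hγ hS hΛ0 hΛ i hx hy).trans (mul_le_mul_of_nonneg_left ?_ hM)
    refine le_sqrt_self_of_le_one (abs_nonneg _) ?_
    rw [abs_le]; constructor <;> linarith [hx.1, hx.2, hy.1, hy.2]
  have h := abs_deriv_pow_three_le_of_abs_le_of_holder (f := fun t => (c t).2 i)
    (g := fun t => -(c t).1 i + γ * OscillatorChain.bathWeight N i * (c t).2 i) hs0 hM hcont
    (fun r hr => hc.hasDerivAt_snd_apply hr i) hε hmod ht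
  rw [sub_zero] at h
  exact h

/-- (TB) **`sup |α_j| ≤ ε ⟹ α̇_j` is cube-small** (part N (C2b) with `f = α_j`,
`g = α̇_j = Σ_i β_i ∂²Φ_{ij}(q_r)`, Hölder-½ constant `√(2N²((1+2γ)²Λ² + C_D²(2/θ²)Θ_θ)) · S`
from part R's `L²` bound of `α̈_j`): for `t ∈ [0, s]`, `0 < s ≤ 1`,
`|α̇_j(t)|³ ≤ 16 ε · (2N²((1+2γ)²Λ² + C_D²(2/θ²)Θ_θ) S²) ∨ |α̇_j(t)| s ≤ 8 ε`,
`C_D = 6 lam (1 + 1/ω₂) + 24 N² β`. [NEW · rung (C2h) beneath (COF)] -/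
theorem IsPathCostate.abs_alphaDot_pow_three_le (hω : 0 < ω₂) (hl : 0 ≤ lam) (hβ : 0 ≤ β)
    (hγ : 0 ≤ γ) {θ : ℝ} (hθ : 0 < θ) {s : ℝ} (hs0 : 0 < s) (hs1 : s ≤ 1) {z : PhaseSpace N}
    {wp : WienerPair} {c : ℝ → PhaseSpace N} (hc : IsPathCostate ω₂ lam β γ N T_L T_R s z wp c)
    {S Λ ε : ℝ} (hS0 : 0 ≤ S) (hS : ∀ t ∈ Icc 0 s, ‖c t‖ ≤ S)
    (hΛ : ∀ t ∈ Icc 0 s, ∀ i j, |(pinnedChain ω₂ lam β γ).hessPotential N i j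
      ((pinnedChain ω₂ lam β γ).solMap N T_L T_R t z (pairPath wp)).1| ≤ Λ)
    (j : Fin N) (hε : ∀ t ∈ Icc 0 s, |(c t).1 j| ≤ ε) {t : ℝ} (ht : t ∈ Icc 0 s) :
    |∑ i, (c t).2 i * (pinnedChain ω₂ lam β γ).hessPotential N i j
          ((pinnedChain ω₂ lam β γ).solMap N T_L T_R t z (pairPath wp)).1| ^ 3 ≤
        16 * ε * (2 * ((N : ℝ) * N) * ((1 + 2 * γ) ^ 2 * Λ ^ 2 +
          (6 * lam * (1 + 1 / ω₂) + (N : ℝ) * N * (24 * β)) ^ 2 * ((2 : ℝ) / θ ^ 2) *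
            energyBudget ω₂ lam β γ N T_L T_R θ z wp) * S ^ 2) ∨
      |∑ i, (c t).2 i * (pinnedChain ω₂ lam β γ).hessPotential N i j
          ((pinnedChain ω₂ lam β γ).solMap N T_L T_R t z (pairPath wp)).1| * s ≤ 8 * ε := by
  have hΘ : 0 ≤ energyBudget ω₂ lam β γ N T_L T_R θ z wp :=
    zero_le_one.trans (one_le_energyBudget (T_L := T_L) (T_R := T_R) hω hl hβ hγ hθ.le z wp)
  set A : ℝ := 2 * ((N : ℝ) * N) * ((1 + 2 * γ) ^ 2 * Λ ^ 2 +
    (6 * lam * (1 + 1 / ω₂) + (N : ℝ) * N * (24 * β)) ^ 2 * ((2 : ℝ) / θ ^ 2) *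
      energyBudget ω₂ lam β γ N T_L T_R θ z wp) with hA
  have hA0 : 0 ≤ A := by positivity
  set M : ℝ := √A * S with hMdef
  have hM : 0 ≤ M := mul_nonneg (Real.sqrt_nonneg _) hS0
  have hcont : ContinuousOn (fun t => (c t).1 j) (Icc 0 s) :=
    ((continuous_apply j).comp continuous_fst).comp_continuousOn hc.1
  have hmod : ∀ x ∈ Icc 0 s, ∀ y ∈ Icc 0 s,
      |(∑ i, (c x).2 i * (pinnedChain ω₂ lam β γ).hessPotential N i j
            ((pinnedChain ω₂ lam β γ).solMap N T_L T_R x z (pairPath wp)).1) -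
          (∑ i, (c y).2 i * (pinnedChain ω₂ lam β γ).hessPotential N i j
            ((pinnedChain ω₂ lam β γ).solMap N T_L T_R y z (pairPath wp)).1)| ≤
        M * √|x - y| := by
    intro x hx y hy
    refine (hc.abs_alphaDot_sub_le hω hl hβ hγ j hx hy).trans
      (mul_le_mul_of_nonneg_right ?_ (Real.sqrt_nonneg _))
    calc √(∫ r in (0 : ℝ)..s, (∑ i, ((-(c r).1 i + γ * OscillatorChain.bathWeight N i *
            (c r).2 i) * (pinnedChain ω₂ lam β γ).hessPotential N i j
              ((pinnedChain ω₂ lam β γ).solMap N T_L T_R r z (pairPath wp)).1 +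
          (c r).2 i * hessDot lam β N i j
            ((pinnedChain ω₂ lam β γ).solMap N T_L T_R r z (pairPath wp)).1
            ((pinnedChain ω₂ lam β γ).solMap N T_L T_R r z (pairPath wp)).2)) ^ 2)
        ≤ √(A * S ^ 2) := Real.sqrt_le_sqrt
          (hc.intervalIntegral_alphaDDot_sq_le hω hl hβ hγ hθ hs0.le hs1 hS hΛ j)
      _ = M := by rw [Real.sqrt_mul hA0, Real.sqrt_sq hS0]
  have h := abs_deriv_pow_three_le_of_abs_le_of_holder (f := fun t => (c t).1 j)
    (g := fun t => ∑ i, (c t).2 i * (pinnedChain ω₂ lam β γ).hessPotential N i j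
      ((pinnedChain ω₂ lam β γ).solMap N T_L T_R t z (pairPath wp)).1) hs0 hM hcont
    (fun r hr => hc.hasDerivAt_fst_apply hr j) hε hmod ht
  have hM2 : M ^ 2 = A * S ^ 2 := by rw [hMdef, mul_pow, Real.sq_sqrt hA0]
  rw [sub_zero, hM2] at h
  exact h

end Costate

end Summit.AtomisticToContinuum.FouriersLaw.Theorems.ExtensiveSnapshotIrreversibility.EnergyWindow
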